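import Summits.QuantumFields.BalabanUV.Beta.GAN24.CombChargeAntisymPairForm
import Summits.QuantumFields.BalabanUV.Beta.GAN24.RowCLevelZero
import Summits.QuantumFields.BalabanUV.Beta.GAN24.T2RecChargeLedger
import Summits.QuantumFields.BalabanUV.Beta.SecondOrderTableLawEnd

/-!
# `BalabanUV.Beta.GAN24.CombChargePairFormTower` — binder row G-an2-4 ∕ (CONV-C), W-slot (α-0), ROW (C) AT LEVELS `≥ 1`, road-P2's JUNCTION BOOKKEEPING:
# **THE ANTISYMMETRIC-PAIR FORM PROPAGATES UP THE COMB TOWER** — the level-`1` member's symmetrised ff charge IS a pair form (the Wilson tensor: leaf-04's `RowCLevelZero` +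
# leaf-02's `WilsonQuarticChargeWsym22` closed forms), one step adds the B-frame SOURCE's charge (MY g36 `T2RecChargeStep.zmodeSym_sourceB_eq` at the pin), so the MEMBER-level
# `hPair` of MY `CombChargeAntisymPairForm` §3 follows from the SOURCE-level pair form `hSrc` (the suppliers' currency), and in `rowC` currency the even-class row of MY F5 §2 is
# «source pair form ∧ crossed zeros» — nothing else (G-an2-4 CRUX TEAM (2), road-P2 chair `b2b-balaban-gan24-p2`, gen 49; journal [GAN24P2-G49-INTENT2])

NOT IN PRINT; OUR BOOKKEEPING ([folklore] finite index algebra, an induction on the level, three closed forms of the tree BY NAME; 0 `def`, 0 cited fact, 0 `def … : Prop`,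
0 sorry).  HONEST FRAMING (cell contract, verbatim): «discharging `BetaPertH` makes Bałaban's UV stability UNCONDITIONAL — a real constructive-QFT result; it is NOT the
continuum limit and NOT the Clay problem.»  HONEST DEPENDENCY (verbatim): «continuum YM on T⁴ ⇐ BetaPertH ∧ nine spine estimates (0/9 proved); BetaPertH ⇐ (D1) ∧ (D4) ∧
CAP+tail; G-an2-4 gates asym, D1 and NE2/3/4.»
WHAT (`LS_m` = the leg-and-bond symmetrisation of `zmode Lc (unitS₂_m T̃_m) κ κ′ (inl κ₁) (inl κ₂)`; «pair form» = `R(κκ₁;κ′κ₂) + R(κ′κ₁;κκ₂) + R(κκ₂;κ′κ₁) + R(κ′κ₂;κκ₁)`,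
`R` antisymmetric in each of its two pairs): §1 **`wilsonTensor_eq_pairForm`** — the Wilson charge tensor `K·(2[μ=ν][α=β] − [μ=β][ν=α] − [μ=α][ν=β])` IS the entrywise pair
form of `K·([a=c][b=e] − [a=e][b=c])`; §2 **`pairFormLS_tower`** — base pair form + pair-form steps ⟹ every level (induction); §3 AT THE LITERAL's PINS (`Odd Lc`, `2 ≤ N`,
`r = ctrOff 4 Lc`, `cE = Lc⁴`, `cE₂ = Lc⁸`, `Tc = (8N²)⁻¹•wsym22 N`, `vh₂S = vh₂SAn1 Lc`; `cVH cΛ cB` free): **`pairFormLS_member_one`** (`LS_1` is a pair form, NO further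
hypothesis), **`pairFormLS_member_of_source`** (`hSrc` — the `rowC` source's `LS`, MY F5 §2's display, is a pair form at every level — ⟹ `hPair`), **`hW0_hHC_hFL_of_sourcePairForm`**
(the three letters of F7 §4 ∕ F8 §2 at every member level from `hSrc` ALONE — `hHC`, «NO HOLDER» as a letter, is DISCHARGED modulo the source pair form),
**`zsymLegSymEven_of_sourcePairForm_crossed`** (`hZeven` ⟸ `hSrc` ∧ `hX`); §4 (NO pins) **`rowCLegSymEven_of_sourcePairForm_crossed`** — F5 §2's `hC₂even` ⟸ `hSrc` ∧
`hSrcX` (the source's crossed orbit sums vanish: 6 scalar identities per level, 1 under pair covariance) = THE END SOCKET of the (TL) programme on road-P2's side.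
Discharges NOTHING of (C) (`hSrc`, `hSrcX`, `hX` are hypotheses), nor (Q-L) ∕ (H1♮) ∕ (hW, hWall); asserts NO value of Bałaban's tables beyond the tree's level-0∕1 closed
forms it composes by name; NEVER «G-an2-4 closed» as (CONV-C); NOT D1, NOT `BetaPertH`, NOT continuum, NOT Clay.  2026-08-23; no existing file touched.
-/

noncomputable section

open Finset
open scoped BigOperators
open Literature.MathematicalPhysics.QuantumFieldTheory
open Literature.MathematicalPhysics.QuantumFieldTheory.Balaban1983to89
open Literature.MathematicalPhysics.QuantumFieldTheory.Balaban1983to89.Beta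
open ExpKernelCalculus (MKer shiftK)
open OneStepResolventKernel (Fib)
open OneStepKernelFamily (KInvStep)
open AveragingContoursRooted (ctrOff ctrOff_mem_box)
open WilsonVertex2Sym (wsym22)
open AffineAveraging (Site box toSite)
open AveragingMixedJetTables (mixFFAt)
open BalabanCompositeJets (LocStencil₂)
open PolarizationSign (reflSign)
open Summit.QuantumFields.BalabanUV.Beta.HessKerDressedUnits (unitK)
open Summit.QuantumFields.BalabanUV.Beta.SecondOrderUnits (unitS₂)
open Summit.QuantumFields.BalabanUV.Beta.SpineRooted (T2RecAt)
open Summit.QuantumFields.BalabanUV.Beta.SecondOrderSocketIdentification (vh₂SAn1 vh₂SAn1_inl_inl vh₂SAn1_inr_inr)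
open Summit.QuantumFields.BalabanUV.Beta.SecondOrderTableLawEnd (locStencil₂_vh₂SAn1 vh₂SAn1_translate)
open Summit.QuantumFields.BalabanUV.Beta.GAN24.CombesThomas (sfStep smStep)
open Summit.QuantumFields.BalabanUV.Beta.GAN24.T2RecursionAffine (lin4)
open Summit.QuantumFields.BalabanUV.Beta.GAN24.BiStencilZeroMode (Tab zmode)
open Summit.QuantumFields.BalabanUV.Beta.GAN24.T2RecChargeStep (zmodeSym_sourceB_eq)
open Summit.QuantumFields.BalabanUV.Beta.GAN24.T2RecChargeLedger (charge_factor_eq_one_of_pinEq)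
open Summit.QuantumFields.BalabanUV.Beta.GAN24.RowCChargeForms (zmode_pi_sub)
open Summit.QuantumFields.BalabanUV.Beta.GAN24.RowCLevelZero (zmode_member_one_eq_member_zero)
open Summit.QuantumFields.BalabanUV.Beta.GAN24.WilsonQuarticChargeWsym22 (zmode_memberZero_wsym22)
open Summit.QuantumFields.BalabanUV.Beta.GAN24.CombChargeEvenClassPatterns (evenClass_induction)
open Summit.QuantumFields.BalabanUV.Beta.GAN24.CombChargeAntisymPairForm (flat_cov_of_pairFormLS diag_eq_crossed_of_pairFormLS pairFormLS_of_pairForm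
  pairFormLS_antisym_fst pairFormLS_antisym_snd antisym_add_fst antisym_add_snd zsymLegSymEven_of_pairFormLS_crossed)

namespace Summit.QuantumFields.BalabanUV.Beta.GAN24.CombChargePairFormTower

/-! ## §1 The Wilson charge tensor is a pair form -/

section Wilson

variable {ι : Type*} [DecidableEq ι]

/-- [folklore] The Wilson pair function `K·([a=c][b=e] − [a=e][b=c])` is antisymmetric in its first pair. -/
theorem wilsonPair_antisym_fst (K : ℝ) (a b c e : ι) :
    K * ((if b = c ∧ a = e then (1 : ℝ) else 0) - (if b = e ∧ a = c then (1 : ℝ) else 0))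
      = -(K * ((if a = c ∧ b = e then (1 : ℝ) else 0) - (if a = e ∧ b = c then (1 : ℝ) else 0))) := by
  have e1 : (b = c ∧ a = e) ↔ (a = e ∧ b = c) := and_comm
  have e2 : (b = e ∧ a = c) ↔ (a = c ∧ b = e) := and_comm
  simp only [e1, e2]; ring

/-- [folklore] The Wilson pair function is antisymmetric in its second pair. -/
theorem wilsonPair_antisym_snd (K : ℝ) (a b c e : ι) :
    K * ((if a = e ∧ b = c then (1 : ℝ) else 0) - (if a = c ∧ b = e then (1 : ℝ) else 0))
      = -(K * ((if a = c ∧ b = e then (1 : ℝ) else 0) - (if a = e ∧ b = c then (1 : ℝ) else 0))) := by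
  ring

/-- NOT IN PRINT; OUR BOOKKEEPING.  **THE WILSON CHARGE TENSOR IS A PAIR FORM**: `K·(2[μ=ν][α=β] − [μ=β][ν=α] − [μ=α][ν=β]) = P(μα;νβ) + P(να;μβ)`,
`P(a,b;c,e) := K·([a=c][b=e] − [a=e][b=c])` (`WilsonQuarticChargeWsym22.zmode_wilsonW₂_wsym22`'s tensor in `pairFormLS_of_pairForm`'s shape). -/
theorem wilsonTensor_eq_pairForm (K : ℝ) (μ ν α β : ι) :
    K * ((if μ = ν ∧ α = β then (2 : ℝ) else 0) - (if μ = β ∧ ν = α then (1 : ℝ) else 0) - (if μ = α ∧ ν = β then (1 : ℝ) else 0))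
      = K * ((if μ = ν ∧ α = β then (1 : ℝ) else 0) - (if μ = β ∧ α = ν then (1 : ℝ) else 0))
        + K * ((if ν = μ ∧ α = β then (1 : ℝ) else 0) - (if ν = β ∧ α = μ then (1 : ℝ) else 0)) := by
  have e1 : (ν = μ ∧ α = β) ↔ (μ = ν ∧ α = β) := ⟨fun h => ⟨h.1.symm, h.2⟩, fun h => ⟨h.1.symm, h.2⟩⟩
  have e2 : (μ = β ∧ α = ν) ↔ (μ = β ∧ ν = α) := ⟨fun h => ⟨h.1, h.2.symm⟩, fun h => ⟨h.1, h.2.symm⟩⟩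
  have e3 : (ν = β ∧ α = μ) ↔ (μ = α ∧ ν = β) := ⟨fun h => ⟨h.2.symm, h.1⟩, fun h => ⟨h.2, h.1.symm⟩⟩
  simp only [e1, e2, e3]
  split_ifs <;> ring

end Wilson

/-! ## §2 The pair form propagates along a tower whose steps add pair forms -/

section Tower

variable {ι : Type*}

/-- NOT IN PRINT; OUR BOOKKEEPING.  **INDUCTION ALONG THE TOWER**: `LS(Z_0)` a pair form ∧ every `LS(Z_(m+1)) − LS(Z_m)` a pair form ⟹ every `LS(Z_m)` a pair form. -/
theorem pairFormLS_tower {Z : ℕ → ι → ι → ι → ι → ℝ}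
    (h0 : ∃ R : ι → ι → ι → ι → ℝ, (∀ a b c e, R b a c e = -R a b c e) ∧ (∀ a b c e, R a b e c = -R a b c e) ∧
      ∀ κ κ' κ₁ κ₂, Z 0 κ κ' κ₁ κ₂ + Z 0 κ' κ κ₁ κ₂ + (Z 0 κ κ' κ₂ κ₁ + Z 0 κ' κ κ₂ κ₁) = R κ κ₁ κ' κ₂ + R κ' κ₁ κ κ₂ + (R κ κ₂ κ' κ₁ + R κ' κ₂ κ κ₁))
    (hstep : ∀ m, ∃ S : ι → ι → ι → ι → ℝ, (∀ a b c e, S b a c e = -S a b c e) ∧ (∀ a b c e, S a b e c = -S a b c e) ∧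
      ∀ κ κ' κ₁ κ₂, (Z (m + 1) κ κ' κ₁ κ₂ + Z (m + 1) κ' κ κ₁ κ₂ + (Z (m + 1) κ κ' κ₂ κ₁ + Z (m + 1) κ' κ κ₂ κ₁))
        - (Z m κ κ' κ₁ κ₂ + Z m κ' κ κ₁ κ₂ + (Z m κ κ' κ₂ κ₁ + Z m κ' κ κ₂ κ₁)) = S κ κ₁ κ' κ₂ + S κ' κ₁ κ κ₂ + (S κ κ₂ κ' κ₁ + S κ' κ₂ κ κ₁))
    (m : ℕ) :
    ∃ R : ι → ι → ι → ι → ℝ, (∀ a b c e, R b a c e = -R a b c e) ∧ (∀ a b c e, R a b e c = -R a b c e) ∧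
      ∀ κ κ' κ₁ κ₂, Z m κ κ' κ₁ κ₂ + Z m κ' κ κ₁ κ₂ + (Z m κ κ' κ₂ κ₁ + Z m κ' κ κ₂ κ₁) = R κ κ₁ κ' κ₂ + R κ' κ₁ κ κ₂ + (R κ κ₂ κ' κ₁ + R κ' κ₂ κ κ₁) := by
  induction m with
  | zero => exact h0
  | succ n ih =>
    obtain ⟨R, hR1, hR2, hR⟩ := ih
    obtain ⟨S, hS1, hS2, hS⟩ := hstep n
    refine ⟨fun a b c e => R a b c e + S a b c e, antisym_add_fst hR1 hS1, antisym_add_snd hR2 hS2, fun κ κ' κ₁ κ₂ => ?_⟩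
    have h1 := hR κ κ' κ₁ κ₂; have h2 := hS κ κ' κ₁ κ₂
    dsimp only; linarith

end Tower

/-! ## §3 At the literal's pins: the base, the tower, the member-level letters, `hZeven` from the source pair form and `hX` -/

section Literal

variable {Lc : ℕ} [NeZero Lc] {r : Fin (3 + 1) → ℕ}

/-- NOT IN PRINT; OUR BOOKKEEPING.  **THE BASE: `LS_1` IS A PAIR FORM** at the literal's pins — level `1` = level `0` (`RowCLevelZero.zmode_member_one_eq_member_zero`,
`cE² = cE₂ = Lc^8`) = `cE₂·(8N²)⁻¹·Lc⁴·(−4N²)`× the Wilson tensor (`WilsonQuarticChargeWsym22.zmode_memberZero_wsym22`), a pair form by §1 (`R = 2P`). -/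
theorem pairFormLS_member_one (hLc : Odd Lc) {N : ℕ} (hN : 2 ≤ N) (hr : r = ctrOff (3 + 1) Lc)
    {cE : ℝ} (cVH cΛ : ℝ) {cE₂ : ℝ} (cB : ℝ) (hcE : cE = (Lc : ℝ) ^ (3 + 1)) (hcE₂ : cE₂ = (Lc : ℝ) ^ (2 * (3 + 1)))
    {Tc : Fin 4 → Fin 4 → Fin 4 → Fin 4 → ℝ} (hTc : Tc = (8 * (N : ℝ) ^ 2)⁻¹ • wsym22 N)
    {vh₂S : Fin (3 + 1) → (Fin (3 + 1) → ℤ) → Fin (3 + 1) → (Fin (3 + 1) → ℤ) → MKer (3 + 1) (Fib 3)} (hvh : vh₂S = vh₂SAn1 Lc) :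
    ∃ R : Fin (3 + 1) → Fin (3 + 1) → Fin (3 + 1) → Fin (3 + 1) → ℝ,
      (∀ a b c e, R b a c e = -R a b c e) ∧ (∀ a b c e, R a b e c = -R a b c e) ∧
      ∀ κ κ' κ₁ κ₂ : Fin (3 + 1),
        zmode Lc (unitS₂ (sfStep Lc (0 + 1)) (smStep 3 Lc (0 + 1)) (T2RecAt 3 Lc (toSite r) cE cVH cΛ cE₂ cB Tc vh₂S (mixFFAt (toSite r) Lc) (0 + 1))) κ κ' (Sum.inl κ₁) (Sum.inl κ₂)
          + zmode Lc (unitS₂ (sfStep Lc (0 + 1)) (smStep 3 Lc (0 + 1)) (T2RecAt 3 Lc (toSite r) cE cVH cΛ cE₂ cB Tc vh₂S (mixFFAt (toSite r) Lc) (0 + 1))) κ' κ (Sum.inl κ₁) (Sum.inl κ₂)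
          + (zmode Lc (unitS₂ (sfStep Lc (0 + 1)) (smStep 3 Lc (0 + 1)) (T2RecAt 3 Lc (toSite r) cE cVH cΛ cE₂ cB Tc vh₂S (mixFFAt (toSite r) Lc) (0 + 1))) κ κ' (Sum.inl κ₂) (Sum.inl κ₁)
          + zmode Lc (unitS₂ (sfStep Lc (0 + 1)) (smStep 3 Lc (0 + 1)) (T2RecAt 3 Lc (toSite r) cE cVH cΛ cE₂ cB Tc vh₂S (mixFFAt (toSite r) Lc) (0 + 1))) κ' κ (Sum.inl κ₂) (Sum.inl κ₁))
        = R κ κ₁ κ' κ₂ + R κ' κ₁ κ κ₂ + (R κ κ₂ κ' κ₁ + R κ' κ₂ κ κ₁) := by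
  have hLc1 : 1 ≤ Lc := hLc.pos
  have hr' : r ∈ box (3 + 1) Lc := hr ▸ ctrOff_mem_box hLc1
  have hpin : cE₂ = (Lc : ℝ) ^ (3 + 5) := hcE₂.trans (by norm_num)
  have hcE2 : cE ^ 2 = (Lc : ℝ) ^ (3 + 5) := by rw [hcE]; ring
  have hN0 : N ≠ 0 := by omega
  have hB : ∃ C δ : ℝ, 0 < δ ∧ LocStencil₂ vh₂S C δ := by rw [hvh]; exact locStencil₂_vh₂SAn1 hLc
  have hBff : ∀ κ u κ' u' x z (α β : Fin (3 + 1)), vh₂S κ u κ' u' x z (Sum.inl α) (Sum.inl β) = 0 := by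
    intro κ u κ' u' x z α β; rw [hvh]; exact vh₂SAn1_inl_inl κ u κ' u' x z α β
  have hBmm : ∀ κ u κ' u' x z (μ' ν' : Fin (3 + 1)), vh₂S κ u κ' u' x z (Sum.inr μ') (Sum.inr ν') = 0 := by
    intro κ u κ' u' x z μ' ν'; rw [hvh]; exact vh₂SAn1_inr_inr κ u κ' u' x z μ' ν'
  have hBt : ∀ (κ : Fin (3 + 1)) (u : Fin (3 + 1) → ℤ) (κ' : Fin (3 + 1)) (u' t : Fin (3 + 1) → ℤ),
      vh₂S κ (u + (Lc : ℤ) • t) κ' (u' + (Lc : ℤ) • t) = shiftK (-((Lc : ℤ) • t)) (vh₂S κ u κ' u') := by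
    intro κ u κ' u' t; rw [hvh]; exact vh₂SAn1_translate hLc1 κ u κ' u' t
  have hK : ∀ X : ℝ, cE₂ * (8 * (N : ℝ) ^ 2)⁻¹ * ((Lc : ℝ) ^ (3 + 1) * (-4 * (N : ℝ) ^ 2 * X)) = (cE₂ * (8 * (N : ℝ) ^ 2)⁻¹ * (Lc : ℝ) ^ (3 + 1) * (-4 * (N : ℝ) ^ 2)) * X := fun X => by ring
  have hent : ∀ μ ν α β : Fin (3 + 1),
      zmode Lc (unitS₂ (sfStep Lc (0 + 1)) (smStep 3 Lc (0 + 1)) (T2RecAt 3 Lc (toSite r) cE cVH cΛ cE₂ cB Tc vh₂S (mixFFAt (toSite r) Lc) (0 + 1))) μ ν (Sum.inl α) (Sum.inl β)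
        = ((cE₂ * (8 * (N : ℝ) ^ 2)⁻¹ * (Lc : ℝ) ^ (3 + 1) * (-4 * (N : ℝ) ^ 2)) * ((if μ = ν ∧ α = β then (1 : ℝ) else 0) - (if μ = β ∧ α = ν then (1 : ℝ) else 0)))
          + ((cE₂ * (8 * (N : ℝ) ^ 2)⁻¹ * (Lc : ℝ) ^ (3 + 1) * (-4 * (N : ℝ) ^ 2)) * ((if ν = μ ∧ α = β then (1 : ℝ) else 0) - (if ν = β ∧ α = μ then (1 : ℝ) else 0))) := by
    intro μ ν α β
    rw [hTc, zmode_member_one_eq_member_zero (d := 3) (by norm_num) hLc1 hr' hN0 cE cVH cΛ cE₂ cB hcE2 hpin hBff hBmm hB hBt μ ν α β,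
      zmode_memberZero_wsym22 (d := 3) Lc cE cVH cΛ cE₂ cB ((8 * (N : ℝ) ^ 2)⁻¹) N (toSite r) hBff μ ν α β, hK, wilsonTensor_eq_pairForm]
  refine ⟨fun a b c e => 2 * ((cE₂ * (8 * (N : ℝ) ^ 2)⁻¹ * (Lc : ℝ) ^ (3 + 1) * (-4 * (N : ℝ) ^ 2)) * ((if a = c ∧ b = e then (1 : ℝ) else 0) - (if a = e ∧ b = c then (1 : ℝ) else 0))), ?_, ?_, fun κ κ' κ₁ κ₂ => ?_⟩
  · intro a b c e
    exact pairFormLS_antisym_fst (P := fun a b c e => ((cE₂ * (8 * (N : ℝ) ^ 2)⁻¹ * (Lc : ℝ) ^ (3 + 1) * (-4 * (N : ℝ) ^ 2)) * ((if a = c ∧ b = e then (1 : ℝ) else 0) - (if a = e ∧ b = c then (1 : ℝ) else 0))))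
      (fun a b c e => wilsonPair_antisym_fst (cE₂ * (8 * (N : ℝ) ^ 2)⁻¹ * (Lc : ℝ) ^ (3 + 1) * (-4 * (N : ℝ) ^ 2)) a b c e) a b c e
  · intro a b c e
    exact pairFormLS_antisym_snd (P := fun a b c e => ((cE₂ * (8 * (N : ℝ) ^ 2)⁻¹ * (Lc : ℝ) ^ (3 + 1) * (-4 * (N : ℝ) ^ 2)) * ((if a = c ∧ b = e then (1 : ℝ) else 0) - (if a = e ∧ b = c then (1 : ℝ) else 0))))
      (fun a b c e => wilsonPair_antisym_snd (cE₂ * (8 * (N : ℝ) ^ 2)⁻¹ * (Lc : ℝ) ^ (3 + 1) * (-4 * (N : ℝ) ^ 2)) a b c e) a b c e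
  · exact pairFormLS_of_pairForm
      (A := fun κ κ' κ₁ κ₂ => zmode Lc (unitS₂ (sfStep Lc (0 + 1)) (smStep 3 Lc (0 + 1)) (T2RecAt 3 Lc (toSite r) cE cVH cΛ cE₂ cB Tc vh₂S (mixFFAt (toSite r) Lc) (0 + 1))) κ κ' (Sum.inl κ₁) (Sum.inl κ₂))
      (P := fun a b c e => ((cE₂ * (8 * (N : ℝ) ^ 2)⁻¹ * (Lc : ℝ) ^ (3 + 1) * (-4 * (N : ℝ) ^ 2)) * ((if a = c ∧ b = e then (1 : ℝ) else 0) - (if a = e ∧ b = c then (1 : ℝ) else 0)))) hent κ κ' κ₁ κ₂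

/-- NOT IN PRINT; OUR BOOKKEEPING.  **THE MEMBER PAIR FORM FROM THE SOURCE PAIR FORM** (`hPair` of `CombChargeAntisymPairForm` §3 ⟸ `hSrc`): at the pins, if for every `l`
the symmetrised `rowC` source charge (MY F5 §2's display) is a pair form, every member level `m + 1` is — §2 from `pairFormLS_member_one` over MY g36
`T2RecChargeStep.zmodeSym_sourceB_eq` (charge factor `1` at the pin, `T2RecChargeLedger.charge_factor_eq_one_of_pinEq`). -/
theorem pairFormLS_member_of_source (hLc : Odd Lc) {N : ℕ} (hN : 2 ≤ N) (hr : r = ctrOff (3 + 1) Lc)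
    {cE : ℝ} (cVH cΛ : ℝ) {cE₂ : ℝ} (cB : ℝ) (hcE : cE = (Lc : ℝ) ^ (3 + 1)) (hcE₂ : cE₂ = (Lc : ℝ) ^ (2 * (3 + 1)))
    {Tc : Fin 4 → Fin 4 → Fin 4 → Fin 4 → ℝ} (hTc : Tc = (8 * (N : ℝ) ^ 2)⁻¹ • wsym22 N)
    {vh₂S : Fin (3 + 1) → (Fin (3 + 1) → ℤ) → Fin (3 + 1) → (Fin (3 + 1) → ℤ) → MKer (3 + 1) (Fib 3)} (hvh : vh₂S = vh₂SAn1 Lc)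
    (hSrc : ∀ l : ℕ, ∃ S : Fin (3 + 1) → Fin (3 + 1) → Fin (3 + 1) → Fin (3 + 1) → ℝ,
      (∀ a b c e, S b a c e = -S a b c e) ∧ (∀ a b c e, S a b e c = -S a b c e) ∧
      ∀ κ κ' κ₁ κ₂ : Fin (3 + 1),
      (zmode Lc ((unitS₂ (sfStep Lc ((l + 1) + 1)) (smStep 3 Lc ((l + 1) + 1)) (T2RecAt 3 Lc (toSite r) cE cVH cΛ cE₂ cB Tc vh₂S (mixFFAt (toSite r) Lc) ((l + 1) + 1)))
             - lin4 (cE₂ * (Lc : ℝ) ^ (2 * (3 + 1))) (unitK (sfStep Lc (l + 1)) (smStep 3 Lc (l + 1)) (KInvStep (d := 3) Lc (l + 1))) Lc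
               (unitS₂ (sfStep Lc (l + 1)) (smStep 3 Lc (l + 1)) (T2RecAt 3 Lc (toSite r) cE cVH cΛ cE₂ cB Tc vh₂S (mixFFAt (toSite r) Lc) (l + 1)))) κ κ' (Sum.inl κ₁) (Sum.inl κ₂)
         + zmode Lc ((unitS₂ (sfStep Lc ((l + 1) + 1)) (smStep 3 Lc ((l + 1) + 1)) (T2RecAt 3 Lc (toSite r) cE cVH cΛ cE₂ cB Tc vh₂S (mixFFAt (toSite r) Lc) ((l + 1) + 1)))
             - lin4 (cE₂ * (Lc : ℝ) ^ (2 * (3 + 1))) (unitK (sfStep Lc (l + 1)) (smStep 3 Lc (l + 1)) (KInvStep (d := 3) Lc (l + 1))) Lc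
               (unitS₂ (sfStep Lc (l + 1)) (smStep 3 Lc (l + 1)) (T2RecAt 3 Lc (toSite r) cE cVH cΛ cE₂ cB Tc vh₂S (mixFFAt (toSite r) Lc) (l + 1)))) κ' κ (Sum.inl κ₁) (Sum.inl κ₂))
      + (zmode Lc ((unitS₂ (sfStep Lc ((l + 1) + 1)) (smStep 3 Lc ((l + 1) + 1)) (T2RecAt 3 Lc (toSite r) cE cVH cΛ cE₂ cB Tc vh₂S (mixFFAt (toSite r) Lc) ((l + 1) + 1)))
             - lin4 (cE₂ * (Lc : ℝ) ^ (2 * (3 + 1))) (unitK (sfStep Lc (l + 1)) (smStep 3 Lc (l + 1)) (KInvStep (d := 3) Lc (l + 1))) Lc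
               (unitS₂ (sfStep Lc (l + 1)) (smStep 3 Lc (l + 1)) (T2RecAt 3 Lc (toSite r) cE cVH cΛ cE₂ cB Tc vh₂S (mixFFAt (toSite r) Lc) (l + 1)))) κ κ' (Sum.inl κ₂) (Sum.inl κ₁)
         + zmode Lc ((unitS₂ (sfStep Lc ((l + 1) + 1)) (smStep 3 Lc ((l + 1) + 1)) (T2RecAt 3 Lc (toSite r) cE cVH cΛ cE₂ cB Tc vh₂S (mixFFAt (toSite r) Lc) ((l + 1) + 1)))
             - lin4 (cE₂ * (Lc : ℝ) ^ (2 * (3 + 1))) (unitK (sfStep Lc (l + 1)) (smStep 3 Lc (l + 1)) (KInvStep (d := 3) Lc (l + 1))) Lc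
               (unitS₂ (sfStep Lc (l + 1)) (smStep 3 Lc (l + 1)) (T2RecAt 3 Lc (toSite r) cE cVH cΛ cE₂ cB Tc vh₂S (mixFFAt (toSite r) Lc) (l + 1)))) κ' κ (Sum.inl κ₂) (Sum.inl κ₁))
        = S κ κ₁ κ' κ₂ + S κ' κ₁ κ κ₂ + (S κ κ₂ κ' κ₁ + S κ' κ₂ κ κ₁))
    (m : ℕ) :
    ∃ R : Fin (3 + 1) → Fin (3 + 1) → Fin (3 + 1) → Fin (3 + 1) → ℝ,
      (∀ a b c e, R b a c e = -R a b c e) ∧ (∀ a b c e, R a b e c = -R a b c e) ∧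
      ∀ κ κ' κ₁ κ₂ : Fin (3 + 1),
        zmode Lc (unitS₂ (sfStep Lc (m + 1)) (smStep 3 Lc (m + 1)) (T2RecAt 3 Lc (toSite r) cE cVH cΛ cE₂ cB Tc vh₂S (mixFFAt (toSite r) Lc) (m + 1))) κ κ' (Sum.inl κ₁) (Sum.inl κ₂)
          + zmode Lc (unitS₂ (sfStep Lc (m + 1)) (smStep 3 Lc (m + 1)) (T2RecAt 3 Lc (toSite r) cE cVH cΛ cE₂ cB Tc vh₂S (mixFFAt (toSite r) Lc) (m + 1))) κ' κ (Sum.inl κ₁) (Sum.inl κ₂)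
          + (zmode Lc (unitS₂ (sfStep Lc (m + 1)) (smStep 3 Lc (m + 1)) (T2RecAt 3 Lc (toSite r) cE cVH cΛ cE₂ cB Tc vh₂S (mixFFAt (toSite r) Lc) (m + 1))) κ κ' (Sum.inl κ₂) (Sum.inl κ₁)
          + zmode Lc (unitS₂ (sfStep Lc (m + 1)) (smStep 3 Lc (m + 1)) (T2RecAt 3 Lc (toSite r) cE cVH cΛ cE₂ cB Tc vh₂S (mixFFAt (toSite r) Lc) (m + 1))) κ' κ (Sum.inl κ₂) (Sum.inl κ₁))
        = R κ κ₁ κ' κ₂ + R κ' κ₁ κ κ₂ + (R κ κ₂ κ' κ₁ + R κ' κ₂ κ κ₁) := by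
  have hLc1 : 1 ≤ Lc := hLc.pos
  have hr' : r ∈ box (3 + 1) Lc := hr ▸ ctrOff_mem_box hLc1
  have hpin : cE₂ = (Lc : ℝ) ^ (3 + 5) := hcE₂.trans (by norm_num)
  have h0 := pairFormLS_member_one hLc hN hr cVH cΛ cB hcE hcE₂ hTc hvh
  have hB : ∃ C δ : ℝ, 0 < δ ∧ LocStencil₂ vh₂S C δ := by rw [hvh]; exact locStencil₂_vh₂SAn1 hLc
  have hBt : ∀ (κ : Fin (3 + 1)) (u : Fin (3 + 1) → ℤ) (κ' : Fin (3 + 1)) (u' t : Fin (3 + 1) → ℤ),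
      vh₂S κ (u + (Lc : ℤ) • t) κ' (u' + (Lc : ℤ) • t) = shiftK (-((Lc : ℤ) • t)) (vh₂S κ u κ' u') := by
    intro κ u κ' u' t; rw [hvh]; exact vh₂SAn1_translate hLc1 κ u κ' u' t
  have H := pairFormLS_tower
    (Z := fun m κ κ' κ₁ κ₂ => zmode Lc (unitS₂ (sfStep Lc (m + 1)) (smStep 3 Lc (m + 1)) (T2RecAt 3 Lc (toSite r) cE cVH cΛ cE₂ cB Tc vh₂S (mixFFAt (toSite r) Lc) (m + 1))) κ κ' (Sum.inl κ₁) (Sum.inl κ₂))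
    h0 (fun n => by
      obtain ⟨S, hS1, hS2, hS⟩ := hSrc n
      refine ⟨S, hS1, hS2, fun κ κ' κ₁ κ₂ => ?_⟩
      have e1 := zmodeSym_sourceB_eq (d := 3) hLc1 hr' cE cVH cΛ cE₂ cB Tc hB hBt Lc (n + 1) κ κ' κ₁ κ₂
      have e2 := zmodeSym_sourceB_eq (d := 3) hLc1 hr' cE cVH cΛ cE₂ cB Tc hB hBt Lc (n + 1) κ κ' κ₂ κ₁
      rw [charge_factor_eq_one_of_pinEq (d := 3) (Lc := Lc) hpin, one_mul] at e1 e2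
      have h := hS κ κ' κ₁ κ₂
      rw [zmode_pi_sub, zmode_pi_sub, zmode_pi_sub, zmode_pi_sub, e1, e2] at h
      linarith) m
  obtain ⟨R, hR1, hR2, hR⟩ := H; exact ⟨R, hR1, hR2, fun κ κ' κ₁ κ₂ => hR κ κ' κ₁ κ₂⟩

/-- NOT IN PRINT; OUR BOOKKEEPING.  **THE THREE MEMBER-LEVEL LETTERS FROM THE SOURCE PAIR FORM**: at the pins, `hSrc` alone gives at every member level `m + 1` the
letters `hW0` ∕ `hHC` («NO HOLDER», OWNER g39 W-4 l.55763 — DISCHARGED modulo the source pair form) ∕ `hFL` of F7 §4 (`flat_cov_of_pairFormLS` on `pairFormLS_member_of_source`). -/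
theorem hW0_hHC_hFL_of_sourcePairForm (hLc : Odd Lc) {N : ℕ} (hN : 2 ≤ N) (hr : r = ctrOff (3 + 1) Lc)
    {cE : ℝ} (cVH cΛ : ℝ) {cE₂ : ℝ} (cB : ℝ) (hcE : cE = (Lc : ℝ) ^ (3 + 1)) (hcE₂ : cE₂ = (Lc : ℝ) ^ (2 * (3 + 1)))
    {Tc : Fin 4 → Fin 4 → Fin 4 → Fin 4 → ℝ} (hTc : Tc = (8 * (N : ℝ) ^ 2)⁻¹ • wsym22 N)
    {vh₂S : Fin (3 + 1) → (Fin (3 + 1) → ℤ) → Fin (3 + 1) → (Fin (3 + 1) → ℤ) → MKer (3 + 1) (Fib 3)} (hvh : vh₂S = vh₂SAn1 Lc)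
    (hSrc : ∀ l : ℕ, ∃ S : Fin (3 + 1) → Fin (3 + 1) → Fin (3 + 1) → Fin (3 + 1) → ℝ,
      (∀ a b c e, S b a c e = -S a b c e) ∧ (∀ a b c e, S a b e c = -S a b c e) ∧
      ∀ κ κ' κ₁ κ₂ : Fin (3 + 1),
      (zmode Lc ((unitS₂ (sfStep Lc ((l + 1) + 1)) (smStep 3 Lc ((l + 1) + 1)) (T2RecAt 3 Lc (toSite r) cE cVH cΛ cE₂ cB Tc vh₂S (mixFFAt (toSite r) Lc) ((l + 1) + 1)))
             - lin4 (cE₂ * (Lc : ℝ) ^ (2 * (3 + 1))) (unitK (sfStep Lc (l + 1)) (smStep 3 Lc (l + 1)) (KInvStep (d := 3) Lc (l + 1))) Lc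
               (unitS₂ (sfStep Lc (l + 1)) (smStep 3 Lc (l + 1)) (T2RecAt 3 Lc (toSite r) cE cVH cΛ cE₂ cB Tc vh₂S (mixFFAt (toSite r) Lc) (l + 1)))) κ κ' (Sum.inl κ₁) (Sum.inl κ₂)
         + zmode Lc ((unitS₂ (sfStep Lc ((l + 1) + 1)) (smStep 3 Lc ((l + 1) + 1)) (T2RecAt 3 Lc (toSite r) cE cVH cΛ cE₂ cB Tc vh₂S (mixFFAt (toSite r) Lc) ((l + 1) + 1)))
             - lin4 (cE₂ * (Lc : ℝ) ^ (2 * (3 + 1))) (unitK (sfStep Lc (l + 1)) (smStep 3 Lc (l + 1)) (KInvStep (d := 3) Lc (l + 1))) Lc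
               (unitS₂ (sfStep Lc (l + 1)) (smStep 3 Lc (l + 1)) (T2RecAt 3 Lc (toSite r) cE cVH cΛ cE₂ cB Tc vh₂S (mixFFAt (toSite r) Lc) (l + 1)))) κ' κ (Sum.inl κ₁) (Sum.inl κ₂))
      + (zmode Lc ((unitS₂ (sfStep Lc ((l + 1) + 1)) (smStep 3 Lc ((l + 1) + 1)) (T2RecAt 3 Lc (toSite r) cE cVH cΛ cE₂ cB Tc vh₂S (mixFFAt (toSite r) Lc) ((l + 1) + 1)))
             - lin4 (cE₂ * (Lc : ℝ) ^ (2 * (3 + 1))) (unitK (sfStep Lc (l + 1)) (smStep 3 Lc (l + 1)) (KInvStep (d := 3) Lc (l + 1))) Lc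
               (unitS₂ (sfStep Lc (l + 1)) (smStep 3 Lc (l + 1)) (T2RecAt 3 Lc (toSite r) cE cVH cΛ cE₂ cB Tc vh₂S (mixFFAt (toSite r) Lc) (l + 1)))) κ κ' (Sum.inl κ₂) (Sum.inl κ₁)
         + zmode Lc ((unitS₂ (sfStep Lc ((l + 1) + 1)) (smStep 3 Lc ((l + 1) + 1)) (T2RecAt 3 Lc (toSite r) cE cVH cΛ cE₂ cB Tc vh₂S (mixFFAt (toSite r) Lc) ((l + 1) + 1)))
             - lin4 (cE₂ * (Lc : ℝ) ^ (2 * (3 + 1))) (unitK (sfStep Lc (l + 1)) (smStep 3 Lc (l + 1)) (KInvStep (d := 3) Lc (l + 1))) Lc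
               (unitS₂ (sfStep Lc (l + 1)) (smStep 3 Lc (l + 1)) (T2RecAt 3 Lc (toSite r) cE cVH cΛ cE₂ cB Tc vh₂S (mixFFAt (toSite r) Lc) (l + 1)))) κ' κ (Sum.inl κ₂) (Sum.inl κ₁))
        = S κ κ₁ κ' κ₂ + S κ' κ₁ κ κ₂ + (S κ κ₂ κ' κ₁ + S κ' κ₂ κ κ₁))
    (m : ℕ) (a b : Fin (3 + 1)) :
    zmode Lc (unitS₂ (sfStep Lc (m + 1)) (smStep 3 Lc (m + 1)) (T2RecAt 3 Lc (toSite r) cE cVH cΛ cE₂ cB Tc vh₂S (mixFFAt (toSite r) Lc) (m + 1))) a a (Sum.inl a) (Sum.inl a) = 0 ∧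
    zmode Lc (unitS₂ (sfStep Lc (m + 1)) (smStep 3 Lc (m + 1)) (T2RecAt 3 Lc (toSite r) cE cVH cΛ cE₂ cB Tc vh₂S (mixFFAt (toSite r) Lc) (m + 1))) a a (Sum.inl b) (Sum.inl b)
      = zmode Lc (unitS₂ (sfStep Lc (m + 1)) (smStep 3 Lc (m + 1)) (T2RecAt 3 Lc (toSite r) cE cVH cΛ cE₂ cB Tc vh₂S (mixFFAt (toSite r) Lc) (m + 1))) b b (Sum.inl a) (Sum.inl a) ∧
    zmode Lc (unitS₂ (sfStep Lc (m + 1)) (smStep 3 Lc (m + 1)) (T2RecAt 3 Lc (toSite r) cE cVH cΛ cE₂ cB Tc vh₂S (mixFFAt (toSite r) Lc) (m + 1))) a a (Sum.inl b) (Sum.inl b) + zmode Lc (unitS₂ (sfStep Lc (m + 1)) (smStep 3 Lc (m + 1)) (T2RecAt 3 Lc (toSite r) cE cVH cΛ cE₂ cB Tc vh₂S (mixFFAt (toSite r) Lc) (m + 1))) b b (Sum.inl a) (Sum.inl a)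
      + (zmode Lc (unitS₂ (sfStep Lc (m + 1)) (smStep 3 Lc (m + 1)) (T2RecAt 3 Lc (toSite r) cE cVH cΛ cE₂ cB Tc vh₂S (mixFFAt (toSite r) Lc) (m + 1))) a b (Sum.inl a) (Sum.inl b) + zmode Lc (unitS₂ (sfStep Lc (m + 1)) (smStep 3 Lc (m + 1)) (T2RecAt 3 Lc (toSite r) cE cVH cΛ cE₂ cB Tc vh₂S (mixFFAt (toSite r) Lc) (m + 1))) b a (Sum.inl a) (Sum.inl b) + (zmode Lc (unitS₂ (sfStep Lc (m + 1)) (smStep 3 Lc (m + 1)) (T2RecAt 3 Lc (toSite r) cE cVH cΛ cE₂ cB Tc vh₂S (mixFFAt (toSite r) Lc) (m + 1))) a b (Sum.inl b) (Sum.inl a) + zmode Lc (unitS₂ (sfStep Lc (m + 1)) (smStep 3 Lc (m + 1)) (T2RecAt 3 Lc (toSite r) cE cVH cΛ cE₂ cB Tc vh₂S (mixFFAt (toSite r) Lc) (m + 1))) b a (Sum.inl b) (Sum.inl a))) = 0 := by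
  obtain ⟨R, hR1, hR2, hE⟩ := pairFormLS_member_of_source hLc hN hr cVH cΛ cB hcE hcE₂ hTc hvh hSrc m
  obtain ⟨hW, hH, hF⟩ := flat_cov_of_pairFormLS
    (A := fun κ κ' κ₁ κ₂ => zmode Lc (unitS₂ (sfStep Lc (m + 1)) (smStep 3 Lc (m + 1)) (T2RecAt 3 Lc (toSite r) cE cVH cΛ cE₂ cB Tc vh₂S (mixFFAt (toSite r) Lc) (m + 1))) κ κ' (Sum.inl κ₁) (Sum.inl κ₂)) hE hR1 hR2
  exact ⟨hW a, hH a b, hF a b⟩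

/-- NOT IN PRINT; OUR BOOKKEEPING.  **`hZeven` FROM THE SOURCE PAIR FORM ∧ THE CROSSED VALUES**: at the pins, `hZeven` of MY F5 §1 (VERBATIM) ⟸ `hSrc` ∧ `hX` (the member's
crossed orbit sums are conserved) — `CombChargeAntisymPairForm.zsymLegSymEven_of_pairFormLS_crossed` on `pairFormLS_member_of_source`. -/
theorem zsymLegSymEven_of_sourcePairForm_crossed (hLc : Odd Lc) {N : ℕ} (hN : 2 ≤ N) (hr : r = ctrOff (3 + 1) Lc)
    {cE : ℝ} (cVH cΛ : ℝ) {cE₂ : ℝ} (cB : ℝ) (hcE : cE = (Lc : ℝ) ^ (3 + 1)) (hcE₂ : cE₂ = (Lc : ℝ) ^ (2 * (3 + 1)))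
    {Tc : Fin 4 → Fin 4 → Fin 4 → Fin 4 → ℝ} (hTc : Tc = (8 * (N : ℝ) ^ 2)⁻¹ • wsym22 N)
    {vh₂S : Fin (3 + 1) → (Fin (3 + 1) → ℤ) → Fin (3 + 1) → (Fin (3 + 1) → ℤ) → MKer (3 + 1) (Fib 3)} (hvh : vh₂S = vh₂SAn1 Lc)
    (hSrc : ∀ l : ℕ, ∃ S : Fin (3 + 1) → Fin (3 + 1) → Fin (3 + 1) → Fin (3 + 1) → ℝ,
      (∀ a b c e, S b a c e = -S a b c e) ∧ (∀ a b c e, S a b e c = -S a b c e) ∧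
      ∀ κ κ' κ₁ κ₂ : Fin (3 + 1),
      (zmode Lc ((unitS₂ (sfStep Lc ((l + 1) + 1)) (smStep 3 Lc ((l + 1) + 1)) (T2RecAt 3 Lc (toSite r) cE cVH cΛ cE₂ cB Tc vh₂S (mixFFAt (toSite r) Lc) ((l + 1) + 1)))
             - lin4 (cE₂ * (Lc : ℝ) ^ (2 * (3 + 1))) (unitK (sfStep Lc (l + 1)) (smStep 3 Lc (l + 1)) (KInvStep (d := 3) Lc (l + 1))) Lc
               (unitS₂ (sfStep Lc (l + 1)) (smStep 3 Lc (l + 1)) (T2RecAt 3 Lc (toSite r) cE cVH cΛ cE₂ cB Tc vh₂S (mixFFAt (toSite r) Lc) (l + 1)))) κ κ' (Sum.inl κ₁) (Sum.inl κ₂)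
         + zmode Lc ((unitS₂ (sfStep Lc ((l + 1) + 1)) (smStep 3 Lc ((l + 1) + 1)) (T2RecAt 3 Lc (toSite r) cE cVH cΛ cE₂ cB Tc vh₂S (mixFFAt (toSite r) Lc) ((l + 1) + 1)))
             - lin4 (cE₂ * (Lc : ℝ) ^ (2 * (3 + 1))) (unitK (sfStep Lc (l + 1)) (smStep 3 Lc (l + 1)) (KInvStep (d := 3) Lc (l + 1))) Lc
               (unitS₂ (sfStep Lc (l + 1)) (smStep 3 Lc (l + 1)) (T2RecAt 3 Lc (toSite r) cE cVH cΛ cE₂ cB Tc vh₂S (mixFFAt (toSite r) Lc) (l + 1)))) κ' κ (Sum.inl κ₁) (Sum.inl κ₂))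
      + (zmode Lc ((unitS₂ (sfStep Lc ((l + 1) + 1)) (smStep 3 Lc ((l + 1) + 1)) (T2RecAt 3 Lc (toSite r) cE cVH cΛ cE₂ cB Tc vh₂S (mixFFAt (toSite r) Lc) ((l + 1) + 1)))
             - lin4 (cE₂ * (Lc : ℝ) ^ (2 * (3 + 1))) (unitK (sfStep Lc (l + 1)) (smStep 3 Lc (l + 1)) (KInvStep (d := 3) Lc (l + 1))) Lc
               (unitS₂ (sfStep Lc (l + 1)) (smStep 3 Lc (l + 1)) (T2RecAt 3 Lc (toSite r) cE cVH cΛ cE₂ cB Tc vh₂S (mixFFAt (toSite r) Lc) (l + 1)))) κ κ' (Sum.inl κ₂) (Sum.inl κ₁)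
         + zmode Lc ((unitS₂ (sfStep Lc ((l + 1) + 1)) (smStep 3 Lc ((l + 1) + 1)) (T2RecAt 3 Lc (toSite r) cE cVH cΛ cE₂ cB Tc vh₂S (mixFFAt (toSite r) Lc) ((l + 1) + 1)))
             - lin4 (cE₂ * (Lc : ℝ) ^ (2 * (3 + 1))) (unitK (sfStep Lc (l + 1)) (smStep 3 Lc (l + 1)) (KInvStep (d := 3) Lc (l + 1))) Lc
               (unitS₂ (sfStep Lc (l + 1)) (smStep 3 Lc (l + 1)) (T2RecAt 3 Lc (toSite r) cE cVH cΛ cE₂ cB Tc vh₂S (mixFFAt (toSite r) Lc) (l + 1)))) κ' κ (Sum.inl κ₂) (Sum.inl κ₁))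
        = S κ κ₁ κ' κ₂ + S κ' κ₁ κ κ₂ + (S κ κ₂ κ' κ₁ + S κ' κ₂ κ κ₁))
    (hX : ∀ (l : ℕ) (a b : Fin (3 + 1)), a ≠ b →
      zmode Lc (unitS₂ (sfStep Lc (l + 1 + 1)) (smStep 3 Lc (l + 1 + 1)) (T2RecAt 3 Lc (toSite r) cE cVH cΛ cE₂ cB Tc vh₂S (mixFFAt (toSite r) Lc) (l + 1 + 1))) a b (Sum.inl a) (Sum.inl b) + zmode Lc (unitS₂ (sfStep Lc (l + 1 + 1)) (smStep 3 Lc (l + 1 + 1)) (T2RecAt 3 Lc (toSite r) cE cVH cΛ cE₂ cB Tc vh₂S (mixFFAt (toSite r) Lc) (l + 1 + 1))) b a (Sum.inl a) (Sum.inl b) + (zmode Lc (unitS₂ (sfStep Lc (l + 1 + 1)) (smStep 3 Lc (l + 1 + 1)) (T2RecAt 3 Lc (toSite r) cE cVH cΛ cE₂ cB Tc vh₂S (mixFFAt (toSite r) Lc) (l + 1 + 1))) a b (Sum.inl b) (Sum.inl a) + zmode Lc (unitS₂ (sfStep Lc (l + 1 + 1)) (smStep 3 Lc (l + 1 + 1))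 (T2RecAt 3 Lc (toSite r) cE cVH cΛ cE₂ cB Tc vh₂S (mixFFAt (toSite r) Lc) (l + 1 + 1))) b a (Sum.inl b) (Sum.inl a))
      = zmode Lc (unitS₂ (sfStep Lc (l + 1)) (smStep 3 Lc (l + 1)) (T2RecAt 3 Lc (toSite r) cE cVH cΛ cE₂ cB Tc vh₂S (mixFFAt (toSite r) Lc) (l + 1))) a b (Sum.inl a) (Sum.inl b) + zmode Lc (unitS₂ (sfStep Lc (l + 1)) (smStep 3 Lc (l + 1)) (T2RecAt 3 Lc (toSite r) cE cVH cΛ cE₂ cB Tc vh₂S (mixFFAt (toSite r) Lc) (l + 1))) b a (Sum.inl a) (Sum.inl b) + (zmode Lc (unitS₂ (sfStep Lc (l + 1)) (smStep 3 Lc (l + 1)) (T2RecAt 3 Lc (toSite r) cE cVH cΛ cE₂ cB Tc vh₂S (mixFFAt (toSite r) Lc) (l + 1))) a b (Sum.inl b) (Sum.inl a) + zmode Lc (unitS₂ (sfStep Lc (l + 1)) (smStep 3 Lc (l + 1)) (T2RecAt 3 Lc (toSite r) cE cVH cΛ cE₂ cB Tc vh₂S (mixFFAt (toSite r) Lc)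 (l + 1))) b a (Sum.inl b) (Sum.inl a)))
    (l : ℕ) (κ κ' κ₁ κ₂ : Fin (3 + 1)) (heven : ¬ ∃ α : Fin 4, reflSign α κ * reflSign α κ' * reflSign α κ₁ * reflSign α κ₂ = -1) :
    zmode Lc (unitS₂ (sfStep Lc (l + 1 + 1)) (smStep 3 Lc (l + 1 + 1)) (T2RecAt 3 Lc (toSite r) cE cVH cΛ cE₂ cB Tc vh₂S (mixFFAt (toSite r) Lc) (l + 1 + 1))) κ κ' (Sum.inl κ₁) (Sum.inl κ₂)
          + zmode Lc (unitS₂ (sfStep Lc (l + 1 + 1)) (smStep 3 Lc (l + 1 + 1)) (T2RecAt 3 Lc (toSite r) cE cVH cΛ cE₂ cB Tc vh₂S (mixFFAt (toSite r) Lc) (l + 1 + 1))) κ' κ (Sum.inl κ₁) (Sum.inl κ₂)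
          + (zmode Lc (unitS₂ (sfStep Lc (l + 1 + 1)) (smStep 3 Lc (l + 1 + 1)) (T2RecAt 3 Lc (toSite r) cE cVH cΛ cE₂ cB Tc vh₂S (mixFFAt (toSite r) Lc) (l + 1 + 1))) κ κ' (Sum.inl κ₂) (Sum.inl κ₁)
          + zmode Lc (unitS₂ (sfStep Lc (l + 1 + 1)) (smStep 3 Lc (l + 1 + 1)) (T2RecAt 3 Lc (toSite r) cE cVH cΛ cE₂ cB Tc vh₂S (mixFFAt (toSite r) Lc) (l + 1 + 1))) κ' κ (Sum.inl κ₂) (Sum.inl κ₁))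
      = zmode Lc (unitS₂ (sfStep Lc (l + 1)) (smStep 3 Lc (l + 1)) (T2RecAt 3 Lc (toSite r) cE cVH cΛ cE₂ cB Tc vh₂S (mixFFAt (toSite r) Lc) (l + 1))) κ κ' (Sum.inl κ₁) (Sum.inl κ₂)
          + zmode Lc (unitS₂ (sfStep Lc (l + 1)) (smStep 3 Lc (l + 1)) (T2RecAt 3 Lc (toSite r) cE cVH cΛ cE₂ cB Tc vh₂S (mixFFAt (toSite r) Lc) (l + 1))) κ' κ (Sum.inl κ₁) (Sum.inl κ₂)
          + (zmode Lc (unitS₂ (sfStep Lc (l + 1)) (smStep 3 Lc (l + 1)) (T2RecAt 3 Lc (toSite r) cE cVH cΛ cE₂ cB Tc vh₂S (mixFFAt (toSite r) Lc) (l + 1))) κ κ' (Sum.inl κ₂) (Sum.inl κ₁)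
          + zmode Lc (unitS₂ (sfStep Lc (l + 1)) (smStep 3 Lc (l + 1)) (T2RecAt 3 Lc (toSite r) cE cVH cΛ cE₂ cB Tc vh₂S (mixFFAt (toSite r) Lc) (l + 1))) κ' κ (Sum.inl κ₂) (Sum.inl κ₁)) :=
  zsymLegSymEven_of_pairFormLS_crossed cE cVH cΛ cE₂ cB Tc vh₂S (pairFormLS_member_of_source hLc hN hr cVH cΛ cB hcE hcE₂ hTc hvh hSrc) hX l κ κ' κ₁ κ₂ heven

end Literal

/-! ## §4 In `rowC` currency, no pins: the even-class row from the source pair form and the crossed zeros -/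

section RowC

variable {Lc : ℕ} [NeZero Lc] {r : Fin (3 + 1) → ℕ}

/-- NOT IN PRINT; OUR BOOKKEEPING.  **THE END SOCKET IN `rowC` CURRENCY**: MY F5 §2's `hC₂even` — the symmetrised charge of the `rowC` source vanishes on every pattern with no
odd axis, every `l` (generic constants, tables, root) — ⟸ `hSrc` (it is a pair form) ∧ `hSrcX` (it vanishes on each crossed orbit); pure algebra per level
(`flat_cov_of_pairFormLS ∕ diag_eq_crossed_of_pairFormLS` on the source, then `CombChargeEvenClassPatterns.evenClass_induction`); no induction, no pin. -/
theorem rowCLegSymEven_of_sourcePairForm_crossed (cE cVH cΛ cE₂ cB : ℝ) (Tc : Fin 4 → Fin 4 → Fin 4 → Fin 4 → ℝ)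
    (vh₂S : Fin (3 + 1) → (Fin (3 + 1) → ℤ) → Fin (3 + 1) → (Fin (3 + 1) → ℤ) → MKer (3 + 1) (Fib 3))
    (hSrc : ∀ l : ℕ, ∃ S : Fin (3 + 1) → Fin (3 + 1) → Fin (3 + 1) → Fin (3 + 1) → ℝ,
      (∀ a b c e, S b a c e = -S a b c e) ∧ (∀ a b c e, S a b e c = -S a b c e) ∧
      ∀ κ κ' κ₁ κ₂ : Fin (3 + 1),
      (zmode Lc ((unitS₂ (sfStep Lc ((l + 1) + 1)) (smStep 3 Lc ((l + 1) + 1)) (T2RecAt 3 Lc (toSite r) cE cVH cΛ cE₂ cB Tc vh₂S (mixFFAt (toSite r) Lc) ((l + 1) + 1)))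
             - lin4 (cE₂ * (Lc : ℝ) ^ (2 * (3 + 1))) (unitK (sfStep Lc (l + 1)) (smStep 3 Lc (l + 1)) (KInvStep (d := 3) Lc (l + 1))) Lc
               (unitS₂ (sfStep Lc (l + 1)) (smStep 3 Lc (l + 1)) (T2RecAt 3 Lc (toSite r) cE cVH cΛ cE₂ cB Tc vh₂S (mixFFAt (toSite r) Lc) (l + 1)))) κ κ' (Sum.inl κ₁) (Sum.inl κ₂)
         + zmode Lc ((unitS₂ (sfStep Lc ((l + 1) + 1)) (smStep 3 Lc ((l + 1) + 1)) (T2RecAt 3 Lc (toSite r) cE cVH cΛ cE₂ cB Tc vh₂S (mixFFAt (toSite r) Lc) ((l + 1) + 1)))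
             - lin4 (cE₂ * (Lc : ℝ) ^ (2 * (3 + 1))) (unitK (sfStep Lc (l + 1)) (smStep 3 Lc (l + 1)) (KInvStep (d := 3) Lc (l + 1))) Lc
               (unitS₂ (sfStep Lc (l + 1)) (smStep 3 Lc (l + 1)) (T2RecAt 3 Lc (toSite r) cE cVH cΛ cE₂ cB Tc vh₂S (mixFFAt (toSite r) Lc) (l + 1)))) κ' κ (Sum.inl κ₁) (Sum.inl κ₂))
      + (zmode Lc ((unitS₂ (sfStep Lc ((l + 1) + 1)) (smStep 3 Lc ((l + 1) + 1)) (T2RecAt 3 Lc (toSite r) cE cVH cΛ cE₂ cB Tc vh₂S (mixFFAt (toSite r) Lc) ((l + 1) + 1)))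
             - lin4 (cE₂ * (Lc : ℝ) ^ (2 * (3 + 1))) (unitK (sfStep Lc (l + 1)) (smStep 3 Lc (l + 1)) (KInvStep (d := 3) Lc (l + 1))) Lc
               (unitS₂ (sfStep Lc (l + 1)) (smStep 3 Lc (l + 1)) (T2RecAt 3 Lc (toSite r) cE cVH cΛ cE₂ cB Tc vh₂S (mixFFAt (toSite r) Lc) (l + 1)))) κ κ' (Sum.inl κ₂) (Sum.inl κ₁)
         + zmode Lc ((unitS₂ (sfStep Lc ((l + 1) + 1)) (smStep 3 Lc ((l + 1) + 1)) (T2RecAt 3 Lc (toSite r) cE cVH cΛ cE₂ cB Tc vh₂S (mixFFAt (toSite r) Lc) ((l + 1) + 1)))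
             - lin4 (cE₂ * (Lc : ℝ) ^ (2 * (3 + 1))) (unitK (sfStep Lc (l + 1)) (smStep 3 Lc (l + 1)) (KInvStep (d := 3) Lc (l + 1))) Lc
               (unitS₂ (sfStep Lc (l + 1)) (smStep 3 Lc (l + 1)) (T2RecAt 3 Lc (toSite r) cE cVH cΛ cE₂ cB Tc vh₂S (mixFFAt (toSite r) Lc) (l + 1)))) κ' κ (Sum.inl κ₂) (Sum.inl κ₁))
        = S κ κ₁ κ' κ₂ + S κ' κ₁ κ κ₂ + (S κ κ₂ κ' κ₁ + S κ' κ₂ κ κ₁))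
    (hSrcX : ∀ (l : ℕ) (a b : Fin (3 + 1)), a ≠ b →
      (zmode Lc ((unitS₂ (sfStep Lc ((l + 1) + 1)) (smStep 3 Lc ((l + 1) + 1)) (T2RecAt 3 Lc (toSite r) cE cVH cΛ cE₂ cB Tc vh₂S (mixFFAt (toSite r) Lc) ((l + 1) + 1)))
             - lin4 (cE₂ * (Lc : ℝ) ^ (2 * (3 + 1))) (unitK (sfStep Lc (l + 1)) (smStep 3 Lc (l + 1)) (KInvStep (d := 3) Lc (l + 1))) Lc
               (unitS₂ (sfStep Lc (l + 1)) (smStep 3 Lc (l + 1)) (T2RecAt 3 Lc (toSite r) cE cVH cΛ cE₂ cB Tc vh₂S (mixFFAt (toSite r) Lc) (l + 1)))) a b (Sum.inl a) (Sum.inl b)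
         + zmode Lc ((unitS₂ (sfStep Lc ((l + 1) + 1)) (smStep 3 Lc ((l + 1) + 1)) (T2RecAt 3 Lc (toSite r) cE cVH cΛ cE₂ cB Tc vh₂S (mixFFAt (toSite r) Lc) ((l + 1) + 1)))
             - lin4 (cE₂ * (Lc : ℝ) ^ (2 * (3 + 1))) (unitK (sfStep Lc (l + 1)) (smStep 3 Lc (l + 1)) (KInvStep (d := 3) Lc (l + 1))) Lc
               (unitS₂ (sfStep Lc (l + 1)) (smStep 3 Lc (l + 1)) (T2RecAt 3 Lc (toSite r) cE cVH cΛ cE₂ cB Tc vh₂S (mixFFAt (toSite r) Lc) (l + 1)))) b a (Sum.inl a) (Sum.inl b))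
      + (zmode Lc ((unitS₂ (sfStep Lc ((l + 1) + 1)) (smStep 3 Lc ((l + 1) + 1)) (T2RecAt 3 Lc (toSite r) cE cVH cΛ cE₂ cB Tc vh₂S (mixFFAt (toSite r) Lc) ((l + 1) + 1)))
             - lin4 (cE₂ * (Lc : ℝ) ^ (2 * (3 + 1))) (unitK (sfStep Lc (l + 1)) (smStep 3 Lc (l + 1)) (KInvStep (d := 3) Lc (l + 1))) Lc
               (unitS₂ (sfStep Lc (l + 1)) (smStep 3 Lc (l + 1)) (T2RecAt 3 Lc (toSite r) cE cVH cΛ cE₂ cB Tc vh₂S (mixFFAt (toSite r) Lc) (l + 1)))) a b (Sum.inl b) (Sum.inl a)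
         + zmode Lc ((unitS₂ (sfStep Lc ((l + 1) + 1)) (smStep 3 Lc ((l + 1) + 1)) (T2RecAt 3 Lc (toSite r) cE cVH cΛ cE₂ cB Tc vh₂S (mixFFAt (toSite r) Lc) ((l + 1) + 1)))
             - lin4 (cE₂ * (Lc : ℝ) ^ (2 * (3 + 1))) (unitK (sfStep Lc (l + 1)) (smStep 3 Lc (l + 1)) (KInvStep (d := 3) Lc (l + 1))) Lc
               (unitS₂ (sfStep Lc (l + 1)) (smStep 3 Lc (l + 1)) (T2RecAt 3 Lc (toSite r) cE cVH cΛ cE₂ cB Tc vh₂S (mixFFAt (toSite r) Lc) (l + 1)))) b a (Sum.inl b) (Sum.inl a)) = 0)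
    (l : ℕ) (κ κ' κ₁ κ₂ : Fin (3 + 1)) (heven : ¬ ∃ α : Fin 4, reflSign α κ * reflSign α κ' * reflSign α κ₁ * reflSign α κ₂ = -1) :
    (zmode Lc ((unitS₂ (sfStep Lc ((l + 1) + 1)) (smStep 3 Lc ((l + 1) + 1)) (T2RecAt 3 Lc (toSite r) cE cVH cΛ cE₂ cB Tc vh₂S (mixFFAt (toSite r) Lc) ((l + 1) + 1)))
             - lin4 (cE₂ * (Lc : ℝ) ^ (2 * (3 + 1))) (unitK (sfStep Lc (l + 1)) (smStep 3 Lc (l + 1)) (KInvStep (d := 3) Lc (l + 1))) Lc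
               (unitS₂ (sfStep Lc (l + 1)) (smStep 3 Lc (l + 1)) (T2RecAt 3 Lc (toSite r) cE cVH cΛ cE₂ cB Tc vh₂S (mixFFAt (toSite r) Lc) (l + 1)))) κ κ' (Sum.inl κ₁) (Sum.inl κ₂)
         + zmode Lc ((unitS₂ (sfStep Lc ((l + 1) + 1)) (smStep 3 Lc ((l + 1) + 1)) (T2RecAt 3 Lc (toSite r) cE cVH cΛ cE₂ cB Tc vh₂S (mixFFAt (toSite r) Lc) ((l + 1) + 1)))
             - lin4 (cE₂ * (Lc : ℝ) ^ (2 * (3 + 1))) (unitK (sfStep Lc (l + 1)) (smStep 3 Lc (l + 1)) (KInvStep (d := 3) Lc (l + 1))) Lc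
               (unitS₂ (sfStep Lc (l + 1)) (smStep 3 Lc (l + 1)) (T2RecAt 3 Lc (toSite r) cE cVH cΛ cE₂ cB Tc vh₂S (mixFFAt (toSite r) Lc) (l + 1)))) κ' κ (Sum.inl κ₁) (Sum.inl κ₂))
      + (zmode Lc ((unitS₂ (sfStep Lc ((l + 1) + 1)) (smStep 3 Lc ((l + 1) + 1)) (T2RecAt 3 Lc (toSite r) cE cVH cΛ cE₂ cB Tc vh₂S (mixFFAt (toSite r) Lc) ((l + 1) + 1)))
             - lin4 (cE₂ * (Lc : ℝ) ^ (2 * (3 + 1))) (unitK (sfStep Lc (l + 1)) (smStep 3 Lc (l + 1)) (KInvStep (d := 3) Lc (l + 1))) Lc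
               (unitS₂ (sfStep Lc (l + 1)) (smStep 3 Lc (l + 1)) (T2RecAt 3 Lc (toSite r) cE cVH cΛ cE₂ cB Tc vh₂S (mixFFAt (toSite r) Lc) (l + 1)))) κ κ' (Sum.inl κ₂) (Sum.inl κ₁)
         + zmode Lc ((unitS₂ (sfStep Lc ((l + 1) + 1)) (smStep 3 Lc ((l + 1) + 1)) (T2RecAt 3 Lc (toSite r) cE cVH cΛ cE₂ cB Tc vh₂S (mixFFAt (toSite r) Lc) ((l + 1) + 1)))
             - lin4 (cE₂ * (Lc : ℝ) ^ (2 * (3 + 1))) (unitK (sfStep Lc (l + 1)) (smStep 3 Lc (l + 1)) (KInvStep (d := 3) Lc (l + 1))) Lc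
               (unitS₂ (sfStep Lc (l + 1)) (smStep 3 Lc (l + 1)) (T2RecAt 3 Lc (toSite r) cE cVH cΛ cE₂ cB Tc vh₂S (mixFFAt (toSite r) Lc) (l + 1)))) κ' κ (Sum.inl κ₂) (Sum.inl κ₁)) = 0 := by
  obtain ⟨S, hS1, hS2, hE⟩ := hSrc l
  obtain ⟨hW, hH, hF⟩ := flat_cov_of_pairFormLS
    (A := fun κ κ' κ₁ κ₂ => zmode Lc ((unitS₂ (sfStep Lc ((l + 1) + 1)) (smStep 3 Lc ((l + 1) + 1)) (T2RecAt 3 Lc (toSite r) cE cVH cΛ cE₂ cB Tc vh₂S (mixFFAt (toSite r) Lc) ((l + 1) + 1)))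
             - lin4 (cE₂ * (Lc : ℝ) ^ (2 * (3 + 1))) (unitK (sfStep Lc (l + 1)) (smStep 3 Lc (l + 1)) (KInvStep (d := 3) Lc (l + 1))) Lc
               (unitS₂ (sfStep Lc (l + 1)) (smStep 3 Lc (l + 1)) (T2RecAt 3 Lc (toSite r) cE cVH cΛ cE₂ cB Tc vh₂S (mixFFAt (toSite r) Lc) (l + 1)))) κ κ' (Sum.inl κ₁) (Sum.inl κ₂)) hE hS1 hS2
  have hD := diag_eq_crossed_of_pairFormLS
    (A := fun κ κ' κ₁ κ₂ => zmode Lc ((unitS₂ (sfStep Lc ((l + 1) + 1)) (smStep 3 Lc ((l + 1) + 1)) (T2RecAt 3 Lc (toSite r) cE cVH cΛ cE₂ cB Tc vh₂S (mixFFAt (toSite r) Lc) ((l + 1) + 1)))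
             - lin4 (cE₂ * (Lc : ℝ) ^ (2 * (3 + 1))) (unitK (sfStep Lc (l + 1)) (smStep 3 Lc (l + 1)) (KInvStep (d := 3) Lc (l + 1))) Lc
               (unitS₂ (sfStep Lc (l + 1)) (smStep 3 Lc (l + 1)) (T2RecAt 3 Lc (toSite r) cE cVH cΛ cE₂ cB Tc vh₂S (mixFFAt (toSite r) Lc) (l + 1)))) κ κ' (Sum.inl κ₁) (Sum.inl κ₂)) hE hS1 hS2
  refine evenClass_induction
    (E := fun κ κ' κ₁ κ₂ =>
      (zmode Lc ((unitS₂ (sfStep Lc ((l + 1) + 1)) (smStep 3 Lc ((l + 1) + 1)) (T2RecAt 3 Lc (toSite r) cE cVH cΛ cE₂ cB Tc vh₂S (mixFFAt (toSite r) Lc) ((l + 1) + 1)))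
             - lin4 (cE₂ * (Lc : ℝ) ^ (2 * (3 + 1))) (unitK (sfStep Lc (l + 1)) (smStep 3 Lc (l + 1)) (KInvStep (d := 3) Lc (l + 1))) Lc
               (unitS₂ (sfStep Lc (l + 1)) (smStep 3 Lc (l + 1)) (T2RecAt 3 Lc (toSite r) cE cVH cΛ cE₂ cB Tc vh₂S (mixFFAt (toSite r) Lc) (l + 1)))) κ κ' (Sum.inl κ₁) (Sum.inl κ₂)
         + zmode Lc ((unitS₂ (sfStep Lc ((l + 1) + 1)) (smStep 3 Lc ((l + 1) + 1)) (T2RecAt 3 Lc (toSite r) cE cVH cΛ cE₂ cB Tc vh₂S (mixFFAt (toSite r) Lc) ((l + 1) + 1)))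
             - lin4 (cE₂ * (Lc : ℝ) ^ (2 * (3 + 1))) (unitK (sfStep Lc (l + 1)) (smStep 3 Lc (l + 1)) (KInvStep (d := 3) Lc (l + 1))) Lc
               (unitS₂ (sfStep Lc (l + 1)) (smStep 3 Lc (l + 1)) (T2RecAt 3 Lc (toSite r) cE cVH cΛ cE₂ cB Tc vh₂S (mixFFAt (toSite r) Lc) (l + 1)))) κ' κ (Sum.inl κ₁) (Sum.inl κ₂))
      + (zmode Lc ((unitS₂ (sfStep Lc ((l + 1) + 1)) (smStep 3 Lc ((l + 1) + 1)) (T2RecAt 3 Lc (toSite r) cE cVH cΛ cE₂ cB Tc vh₂S (mixFFAt (toSite r) Lc) ((l + 1) + 1)))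
             - lin4 (cE₂ * (Lc : ℝ) ^ (2 * (3 + 1))) (unitK (sfStep Lc (l + 1)) (smStep 3 Lc (l + 1)) (KInvStep (d := 3) Lc (l + 1))) Lc
               (unitS₂ (sfStep Lc (l + 1)) (smStep 3 Lc (l + 1)) (T2RecAt 3 Lc (toSite r) cE cVH cΛ cE₂ cB Tc vh₂S (mixFFAt (toSite r) Lc) (l + 1)))) κ κ' (Sum.inl κ₂) (Sum.inl κ₁)
         + zmode Lc ((unitS₂ (sfStep Lc ((l + 1) + 1)) (smStep 3 Lc ((l + 1) + 1)) (T2RecAt 3 Lc (toSite r) cE cVH cΛ cE₂ cB Tc vh₂S (mixFFAt (toSite r) Lc) ((l + 1) + 1)))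
             - lin4 (cE₂ * (Lc : ℝ) ^ (2 * (3 + 1))) (unitK (sfStep Lc (l + 1)) (smStep 3 Lc (l + 1)) (KInvStep (d := 3) Lc (l + 1))) Lc
               (unitS₂ (sfStep Lc (l + 1)) (smStep 3 Lc (l + 1)) (T2RecAt 3 Lc (toSite r) cE cVH cΛ cE₂ cB Tc vh₂S (mixFFAt (toSite r) Lc) (l + 1)))) κ' κ (Sum.inl κ₂) (Sum.inl κ₁)) = 0)
    ?_ ?_ ?_ ?_ ?_ κ κ' κ₁ κ₂ heven
  · intro κ κ' κ₁ κ₂ h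
    linarith
  · intro κ κ' κ₁ κ₂ h
    linarith
  · intro a
    have h := hW a
    beta_reduce at h
    linarith
  · intro a b hab
    have h1 := hD a b
    have h2 := hSrcX l a b hab
    beta_reduce at h1
    linarith
  · intro a b hab
    exact hSrcX l a b hab

end RowC

end Summit.QuantumFields.BalabanUV.Beta.GAN24.CombChargePairFormTower

end
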